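import Mathlib
import Summits.ResolutionOfSingularities.ResolutionOfSingularities.Theorems.RadicialJungCleanModelsCleanProp44PhaseTwoNCP
import HarnessLib

/-!
# Route `RadicialJung`, crux `CleanModels` (stmt-ResolutionOfSingularities-15917), line `Sketch` rev 35, stub 6 `stub_cleanProp44` (X44c):
# (R1ᵐⁱⁿ) ⟸ (R1ⁿᶜᵖ) — a `Λ`-minimal no-bad stage is an insertion-forced stage

Seat decomp-res-hand-2 g17, companion of `…CleanProp44PhaseTwoMin.lean` (twelfth cut X44c ⟸ (R1ᵐⁱⁿ) ∧ (R3ᵛⁿ′)) and of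
`…CleanProp44PhaseTwoNCP.lean` (eleventh cut X44c ⟸ (R1ⁿᶜᵖ) ∧ (R3ᵛⁿ′)).

* `phaseTwoMin_of_phaseTwoNCP` — **(R1ᵐⁱⁿ) ⟸ (R1ⁿᶜᵖ)** as hypothesis schemas: at a no-bad stage from which no clean-permissible sequence reaches a
  no-bad stage of smaller printed potential `Λ = Σ_{η} λ(𝒪_{X,η}/J_η)`, every curve of `Σ = {ord ≥ μ}` meeting another one has a point at which the
  line of `G` is NOT clean-permissible for it — otherwise its blowing up is a clean-permissible step (✓ `IsCleanPermissibleSeq.cons`) to a stage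
  without bad points (✓ `CP2008Prop44.curveStep_noBad`) of smaller `Λ` (✓ `CP2008Prop44.curveStep_potential_lt`).  So the residual hypothesis schema
  (R1ⁿᶜᵖ) of the eleventh cut implies the residual (R1ᵐⁱⁿ) of the twelfth: the twelfth cut is the stronger reduction, the eleventh its readable
  corollary.

Honest framing: OURS; neither residual is proved here; nothing here proves X44c, any case of `CleanModels`, or resolution of singularities in
characteristic `p`. [cite: CossartPiltant2008, Prop. 4.4 (proof, p. 10, step 3); Lemma 4.3 (2) (4)] [cite: Piltant2013, §2 Axiom 4]
-/
noncomputable section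

set_option linter.dupNamespace false -- mandated namespace of this single-conjunct summit

open CategoryTheory CategoryTheory.Limits AlgebraicGeometry TopologicalSpace IsLocalRing
open Literature.AlgebraicGeometry.Resolution Literature.AlgebraicGeometry.Motives
open Scheme.IdealSheafData
open Summit.ResolutionOfSingularities.ResolutionOfSingularities.Theorems.CP2008Prop44

namespace Summit.ResolutionOfSingularities.ResolutionOfSingularities.Theorems.RadicialJung.CleanModels

/-! ## §1 (R1ᵐⁱⁿ) ⟸ (R1ⁿᶜᵖ): a `Λ`-minimal stage is an insertion-forced stage -/

set_option maxHeartbeats 1600000 in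
-- long binder lists; one curve blowing-up with its bookkeeping
/-- **(R1ᵐⁱⁿ) ⟸ (R1ⁿᶜᵖ).**  At a no-bad stage that is `Λ`-minimal (hypothesis `(min)`), every curve of `Σ` meeting another one has a point at which
the line is NOT clean-permissible for it: otherwise its blowing up is a clean-permissible step (✓ `IsCleanPermissibleSeq.cons`) reaching a stage
without bad points (✓ `curveStep_noBad`) of strictly smaller `Λ` (✓ `curveStep_potential_lt`).  Hence the insertion-forced residual (R1ⁿᶜᵖ) of the
eleventh cut implies the `Λ`-minimal residual (R1ᵐⁱⁿ), and the eleventh cut factors through the twelfth.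
[cite: CossartPiltant2008, Prop. 4.4 (proof, p. 10, step 3); Lemma 4.3 (2) (4)] [cite: Piltant2013, §2 Axiom 4] -/
theorem phaseTwoMin_of_phaseTwoNCP
    (hphaseTwoNCP : ∀ (p : ℕ), p.Prime → ∀ {X : Scheme.{0}} [IsIntegral X] [IsNoetherian X], CharP X.functionField p →
      ∀ (hX : Scheme.IsRegular X), Scheme.IsQuasiExcellent X → topologicalKrullDim X ≤ 3 →
      ∀ (G : X.functionField), (∀ x : X, CleanRegAt p (algebraMap (X.presheaf.stalk x) X.functionField) G) →
      ∀ (J : X.IdealSheafData) {μ : ℕ}, 1 ≤ μ → (∀ z, idealOrder J z ≤ μ) → (∀ z ∈ J.support, 1 < Order.coheight z) →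
      (∀ x : X, ¬ ∃ C ∈ {C : Closeds X | ∃ ζ ∈ maxPoints {z : X | (μ : ℕ∞) ≤ idealOrder J z},
          ¬ IsClosed ({ζ} : Set X) ∧ C = ⟨closure {ζ}, isClosed_closure⟩},
        x ∈ (vanishingIdeal C).subschemeι '' (Scheme.regularLocus (vanishingIdeal C).subscheme)ᶜ ∨
        (x ∈ (C : Set X) ∧ ∃ C' ∈ {C : Closeds X | ∃ ζ ∈ maxPoints {z : X | (μ : ℕ∞) ≤ idealOrder J z},
            ¬ IsClosed ({ζ} : Set X) ∧ C = ⟨closure {ζ}, isClosed_closure⟩}, C' ≠ C ∧ x ∈ (C' : Set X) ∧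
          stalkIdeal (vanishingIdeal C) x ⊔ stalkIdeal (vanishingIdeal C') x ≠ maximalIdeal (X.presheaf.stalk x))) →
      -- (meet) two distinct curves of `Σ` meet
      (∃ ζ₁ ζ₂ : X, (μ : ℕ∞) ≤ idealOrder J ζ₁ ∧ Order.coheight ζ₁ = 2 ∧ ¬ IsClosed ({ζ₁} : Set X) ∧
          (μ : ℕ∞) ≤ idealOrder J ζ₂ ∧ Order.coheight ζ₂ = 2 ∧ ¬ IsClosed ({ζ₂} : Set X) ∧ ζ₁ ≠ ζ₂ ∧
          ¬ Disjoint (closure ({ζ₁} : Set X)) (closure {ζ₂})) →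
      -- (ncp) every curve of `Σ` meeting another one has a point at which the line is NOT clean-permissible for it
      (∀ ζ₁ : X, (μ : ℕ∞) ≤ idealOrder J ζ₁ → Order.coheight ζ₁ = 2 → ¬ IsClosed ({ζ₁} : Set X) →
          (∃ ζ₂ : X, (μ : ℕ∞) ≤ idealOrder J ζ₂ ∧ Order.coheight ζ₂ = 2 ∧ ¬ IsClosed ({ζ₂} : Set X) ∧ ζ₁ ≠ ζ₂ ∧
            ¬ Disjoint (closure ({ζ₁} : Set X)) (closure {ζ₂})) →
          ∃ y ∈ closure ({ζ₁} : Set X), ¬ CleanPermissibleAt p (algebraMap (X.presheaf.stalk y) X.functionField) G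
            (stalkIdeal (vanishingIdeal (⟨closure {ζ₁}, isClosed_closure⟩ : Closeds X)) y)) →
      ∃ (X₁ : Scheme.{0}) (Φ : X₁ ⟶ X) (_ : IsIntegral X₁) (_ : IsDominant Φ) (J₁ : X₁.IdealSheafData)
        (_ : IsCleanPermissibleSeq p Φ J μ J₁ G),
        (∀ ζ : X₁, (μ : ℕ∞) ≤ idealOrder J₁ ζ → Order.coheight ζ = 2 → ¬ IsClosed ({ζ} : Set X₁) →
            Scheme.IsRegular (vanishingIdeal (⟨closure {ζ}, isClosed_closure⟩ : Closeds X₁)).subscheme) ∧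
        (∀ ζ₁ ζ₂ : X₁, (μ : ℕ∞) ≤ idealOrder J₁ ζ₁ → Order.coheight ζ₁ = 2 → ¬ IsClosed ({ζ₁} : Set X₁) →
            (μ : ℕ∞) ≤ idealOrder J₁ ζ₂ → Order.coheight ζ₂ = 2 → ¬ IsClosed ({ζ₂} : Set X₁) → ζ₁ ≠ ζ₂ →
            Disjoint (closure ({ζ₁} : Set X₁)) (closure {ζ₂}))) :
    ∀ (p : ℕ), p.Prime → ∀ {X : Scheme.{0}} [IsIntegral X] [IsNoetherian X], CharP X.functionField p →
      ∀ (hX : Scheme.IsRegular X), Scheme.IsQuasiExcellent X → topologicalKrullDim X ≤ 3 →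
      ∀ (G : X.functionField), (∀ x : X, CleanRegAt p (algebraMap (X.presheaf.stalk x) X.functionField) G) →
      ∀ (J : X.IdealSheafData) {μ : ℕ}, 1 ≤ μ → (∀ z, idealOrder J z ≤ μ) → (∀ z ∈ J.support, 1 < Order.coheight z) →
      (∀ x : X, ¬ ∃ C ∈ {C : Closeds X | ∃ ζ ∈ maxPoints {z : X | (μ : ℕ∞) ≤ idealOrder J z},
          ¬ IsClosed ({ζ} : Set X) ∧ C = ⟨closure {ζ}, isClosed_closure⟩},
        x ∈ (vanishingIdeal C).subschemeι '' (Scheme.regularLocus (vanishingIdeal C).subscheme)ᶜ ∨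
        (x ∈ (C : Set X) ∧ ∃ C' ∈ {C : Closeds X | ∃ ζ ∈ maxPoints {z : X | (μ : ℕ∞) ≤ idealOrder J z},
            ¬ IsClosed ({ζ} : Set X) ∧ C = ⟨closure {ζ}, isClosed_closure⟩}, C' ≠ C ∧ x ∈ (C' : Set X) ∧
          stalkIdeal (vanishingIdeal C) x ⊔ stalkIdeal (vanishingIdeal C') x ≠ maximalIdeal (X.presheaf.stalk x))) →
      -- (meet) two distinct curves of `Σ` meet
      (∃ ζ₁ ζ₂ : X, (μ : ℕ∞) ≤ idealOrder J ζ₁ ∧ Order.coheight ζ₁ = 2 ∧ ¬ IsClosed ({ζ₁} : Set X) ∧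
          (μ : ℕ∞) ≤ idealOrder J ζ₂ ∧ Order.coheight ζ₂ = 2 ∧ ¬ IsClosed ({ζ₂} : Set X) ∧ ζ₁ ≠ ζ₂ ∧
          ¬ Disjoint (closure ({ζ₁} : Set X)) (closure {ζ₂})) →
      -- (min) `Λ` does not drop along any clean-permissible sequence reaching a stage without bad points
      (∀ (X₁ : Scheme.{0}) [IsIntegral X₁] (Φ : X₁ ⟶ X) [IsDominant Φ] (J₁ : X₁.IdealSheafData),
        IsCleanPermissibleSeq p Φ J μ J₁ G →
        (∀ x : X₁, ¬ ∃ C ∈ {C : Closeds X₁ | ∃ ζ ∈ maxPoints {z : X₁ | (μ : ℕ∞) ≤ idealOrder J₁ z},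
            ¬ IsClosed ({ζ} : Set X₁) ∧ C = ⟨closure {ζ}, isClosed_closure⟩},
          x ∈ (vanishingIdeal C).subschemeι '' (Scheme.regularLocus (vanishingIdeal C).subscheme)ᶜ ∨
          (x ∈ (C : Set X₁) ∧ ∃ C' ∈ {C : Closeds X₁ | ∃ ζ ∈ maxPoints {z : X₁ | (μ : ℕ∞) ≤ idealOrder J₁ z},
              ¬ IsClosed ({ζ} : Set X₁) ∧ C = ⟨closure {ζ}, isClosed_closure⟩}, C' ≠ C ∧ x ∈ (C' : Set X₁) ∧
            stalkIdeal (vanishingIdeal C) x ⊔ stalkIdeal (vanishingIdeal C') x ≠ maximalIdeal (X₁.presheaf.stalk x))) →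
        (∑ᶠ ζ ∈ {ζ : X | ζ ∈ maxPoints {z : X | (μ : ℕ∞) ≤ idealOrder J z} ∧ ¬ IsClosed ({ζ} : Set X)},
            (Module.length (X.presheaf.stalk ζ) (X.presheaf.stalk ζ ⧸ stalkIdeal J ζ)).toNat) ≤
          (∑ᶠ ζ ∈ {ζ : X₁ | ζ ∈ maxPoints {z : X₁ | (μ : ℕ∞) ≤ idealOrder J₁ z} ∧ ¬ IsClosed ({ζ} : Set X₁)},
              (Module.length (X₁.presheaf.stalk ζ) (X₁.presheaf.stalk ζ ⧸ stalkIdeal J₁ ζ)).toNat)) →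
      ∃ (X₁ : Scheme.{0}) (Φ : X₁ ⟶ X) (_ : IsIntegral X₁) (_ : IsDominant Φ) (J₁ : X₁.IdealSheafData)
        (_ : IsCleanPermissibleSeq p Φ J μ J₁ G),
        (∀ ζ : X₁, (μ : ℕ∞) ≤ idealOrder J₁ ζ → Order.coheight ζ = 2 → ¬ IsClosed ({ζ} : Set X₁) →
            Scheme.IsRegular (vanishingIdeal (⟨closure {ζ}, isClosed_closure⟩ : Closeds X₁)).subscheme) ∧
        (∀ ζ₁ ζ₂ : X₁, (μ : ℕ∞) ≤ idealOrder J₁ ζ₁ → Order.coheight ζ₁ = 2 → ¬ IsClosed ({ζ₁} : Set X₁) →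
            (μ : ℕ∞) ≤ idealOrder J₁ ζ₂ → Order.coheight ζ₂ = 2 → ¬ IsClosed ({ζ₂} : Set X₁) → ζ₁ ≠ ζ₂ →
            Disjoint (closure ({ζ₁} : Set X₁)) (closure {ζ₂})) := by
  intro p hp X _ _ hchar hX hqe hX3 G hG J μ hμ hle hcodim hRT hmeet hmin
  classical
  haveI := hchar
  refine hphaseTwoNCP p hp hchar hX hqe hX3 G hG J hμ hle hcodim hRT hmeet ?_
  intro ζ₁ hζ₁ord hζ₁coh hζ₁cl _
  by_contra hno
  push Not at hno
  -- the invariants at every reachable stage (over the forgetful map to the W4.6 currency)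
  have inv := fun {X₁ : Scheme.{0}} [IsIntegral X₁] {Φ : X₁ ⟶ X} [IsDominant Φ] {J₁ : X₁.IdealSheafData}
      (h : IsCleanPermissibleSeq p Φ J μ J₁ G) =>
    IsPermissibleBlowupSeq.prop44Invariants hX hqe hμ hle hcodim (isPermissibleBlowupSeq_of_isPermissibleSeq h.isPermissibleSeq)
  -- finitely many curves of `Σ` at every reachable stage
  have hfin : ∀ {X₁ : Scheme.{0}} [IsIntegral X₁] {Φ : X₁ ⟶ X} [IsDominant Φ] {J₁ : X₁.IdealSheafData},
      IsCleanPermissibleSeq p Φ J μ J₁ G →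
      {ζ : X₁ | ζ ∈ maxPoints {z : X₁ | (μ : ℕ∞) ≤ idealOrder J₁ z} ∧ ¬ IsClosed ({ζ} : Set X₁)}.Finite := by
    intro X₁ _ Φ _ J₁ h
    obtain ⟨-, hnoeth₁, hX₁, hqe₁, -, hcodim₁⟩ := inv h
    haveI := hnoeth₁
    have hJne : J₁ ≠ ⊥ := ne_bot_of_forall_one_lt_coheight hcodim₁
    have hcl : IsClosed {z : X₁ | (μ : ℕ∞) ≤ idealOrder J₁ z} :=
      isClosed_setOf_le_idealOrder_of_isJ2 hX₁ (fun U => (hqe₁ U).isJ2Ring) hJne μ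
    exact (maxPoints_finite hcl).subset fun ζ hζ => hζ.1
  have hcoh3 : ∀ z : X, Order.coheight z ≤ 3 := (topologicalKrullDim_le_iff_forall_coheight_le X 3).mp hX3
  -- the meeting curve `Y = cl{ζ₁}` of `Σ`, clean-permissible at each of its points
  have hY : (⟨closure {ζ₁}, isClosed_closure⟩ : Closeds X) ∈ {C : Closeds X | ∃ ζ ∈ maxPoints
      {z : X | (μ : ℕ∞) ≤ idealOrder J z}, ¬ IsClosed ({ζ} : Set X) ∧ C = ⟨closure {ζ}, isClosed_closure⟩} :=
    ⟨ζ₁, mem_maxPoints_setOf_of_coheight_eq_two hμ hcoh3 hcodim hζ₁ord hζ₁coh, hζ₁cl, rfl⟩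
  have hcurve := curve_of_noBad hX hX3 J hμ hle hcodim (𝒞 := {C : Closeds X | _}) (fun C => Iff.rfl) hRT hY
  obtain ⟨hYreg, -, hYord, -, -⟩ := hcurve
  -- blow it up: a clean-permissible step
  have hb := exists_isBlowup X (vanishingIdeal (⟨closure {ζ₁}, isClosed_closure⟩ : Closeds X))
  obtain ⟨X₂, π, hπ⟩ := hb
  have hJne : J ≠ ⊥ := ne_bot_of_forall_one_lt_coheight hcodim
  have hYne : vanishingIdeal (⟨closure {ζ₁}, isClosed_closure⟩ : Closeds X) ≠ ⊥ :=
    vanishingIdeal_ne_bot_of_forall_idealOrder_eq hJne hμ hYord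
  haveI : IsIntegral X₂ := hπ.isIntegral hYne
  haveI : IsDominant π := isDominant_of_isBlowup_of_ne_bot hπ hYne
  haveI : IsLocallyNoetherian X₂ := hπ.isLocallyNoetherian
  have hseq₀ : IsCleanPermissibleSeq p (𝟙 X) J μ J G := IsCleanPermissibleSeq.nil J μ G
  have hseq₂' : IsCleanPermissibleSeq p (π ≫ 𝟙 X) J μ
      (controlledTransform π (vanishingIdeal (⟨closure {ζ₁}, isClosed_closure⟩ : Closeds X)) J μ) G :=
    IsCleanPermissibleSeq.cons π (𝟙 X) J μ J G ⟨closure {ζ₁}, isClosed_closure⟩ hseq₀ (isIntegral_subscheme_closure ζ₁)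
      hYreg hYord hπ (fun y hy => by rw [RatFn.functionFieldMap_id]; exact hno y hy)
  have hseq₂ : IsCleanPermissibleSeq p π J μ
      (controlledTransform π (vanishingIdeal (⟨closure {ζ₁}, isClosed_closure⟩ : Closeds X)) J μ) G := by
    simpa only [Category.comp_id] using hseq₂'
  -- the invariants upstairs; no bad point upstairs; the potential drops
  obtain ⟨-, hnoeth₂, -, -, hle₂, -⟩ := inv hseq₂
  haveI := hnoeth₂
  have hI₂ := curveStep_noBad hX hX3 J hμ hle hcodim (𝒞 := {C : Closeds X | _}) (fun C => Iff.rfl) hRT hY hπ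
    (𝒞' := {C : Closeds X₂ | _}) (fun C' => Iff.rfl)
  have hlt := curveStep_potential_lt hX hX3 J hμ hle hcodim (𝒞 := {C : Closeds X | _}) (fun C => Iff.rfl) hRT hY hπ
    hle₂ (hfin hseq₀) (hfin hseq₂)
  -- against `Λ`-minimality
  have hge := hmin X₂ π _ hseq₂ hI₂
  exact absurd hge (not_le.mpr hlt)


/-! ## §2 The trivial direction: (R1ⁿᶜᵖ) ⟸ (R1), so that (R1) ⟺ (R1ⁿᶜᵖ) ⟺ (R1ᵐⁱⁿ) -/

set_option maxHeartbeats 800000 in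
-- long binder lists
/-- **(R1ⁿᶜᵖ) ⟸ (R1)** (drop the two inserted hypotheses).  With ✓ `phaseTwo_of_phaseTwoMin` (`…CleanProp44PhaseTwoMin.lean`) and
`phaseTwoMin_of_phaseTwoNCP` above, the three hypothesis schemas (R1) clean Phase II, (R1ⁿᶜᵖ) its insertion-forced residual and (R1ᵐⁱⁿ) its
`Λ`-minimal residual are KERNEL-EQUIVALENT: the eleventh and twelfth cuts lose nothing. [cite: CossartPiltant2008, Prop. 4.4 (proof, p. 10, step 3)] -/
theorem phaseTwoNCP_of_phaseTwo
    (hphaseTwo : ∀ (p : ℕ), p.Prime → ∀ {X : Scheme.{0}} [IsIntegral X] [IsNoetherian X], CharP X.functionField p →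
      ∀ (hX : Scheme.IsRegular X), Scheme.IsQuasiExcellent X → topologicalKrullDim X ≤ 3 →
      ∀ (G : X.functionField), (∀ x : X, CleanRegAt p (algebraMap (X.presheaf.stalk x) X.functionField) G) →
      ∀ (J : X.IdealSheafData) {μ : ℕ}, 1 ≤ μ → (∀ z, idealOrder J z ≤ μ) → (∀ z ∈ J.support, 1 < Order.coheight z) →
      (∀ x : X, ¬ ∃ C ∈ {C : Closeds X | ∃ ζ ∈ maxPoints {z : X | (μ : ℕ∞) ≤ idealOrder J z},
          ¬ IsClosed ({ζ} : Set X) ∧ C = ⟨closure {ζ}, isClosed_closure⟩},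
        x ∈ (vanishingIdeal C).subschemeι '' (Scheme.regularLocus (vanishingIdeal C).subscheme)ᶜ ∨
        (x ∈ (C : Set X) ∧ ∃ C' ∈ {C : Closeds X | ∃ ζ ∈ maxPoints {z : X | (μ : ℕ∞) ≤ idealOrder J z},
            ¬ IsClosed ({ζ} : Set X) ∧ C = ⟨closure {ζ}, isClosed_closure⟩}, C' ≠ C ∧ x ∈ (C' : Set X) ∧
          stalkIdeal (vanishingIdeal C) x ⊔ stalkIdeal (vanishingIdeal C') x ≠ maximalIdeal (X.presheaf.stalk x))) →
      ∃ (X₁ : Scheme.{0}) (Φ : X₁ ⟶ X) (_ : IsIntegral X₁) (_ : IsDominant Φ) (J₁ : X₁.IdealSheafData)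
        (_ : IsCleanPermissibleSeq p Φ J μ J₁ G),
        (∀ ζ : X₁, (μ : ℕ∞) ≤ idealOrder J₁ ζ → Order.coheight ζ = 2 → ¬ IsClosed ({ζ} : Set X₁) →
            Scheme.IsRegular (vanishingIdeal (⟨closure {ζ}, isClosed_closure⟩ : Closeds X₁)).subscheme) ∧
        (∀ ζ₁ ζ₂ : X₁, (μ : ℕ∞) ≤ idealOrder J₁ ζ₁ → Order.coheight ζ₁ = 2 → ¬ IsClosed ({ζ₁} : Set X₁) →
            (μ : ℕ∞) ≤ idealOrder J₁ ζ₂ → Order.coheight ζ₂ = 2 → ¬ IsClosed ({ζ₂} : Set X₁) → ζ₁ ≠ ζ₂ →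
            Disjoint (closure ({ζ₁} : Set X₁)) (closure {ζ₂}))) :
    ∀ (p : ℕ), p.Prime → ∀ {X : Scheme.{0}} [IsIntegral X] [IsNoetherian X], CharP X.functionField p →
      ∀ (hX : Scheme.IsRegular X), Scheme.IsQuasiExcellent X → topologicalKrullDim X ≤ 3 →
      ∀ (G : X.functionField), (∀ x : X, CleanRegAt p (algebraMap (X.presheaf.stalk x) X.functionField) G) →
      ∀ (J : X.IdealSheafData) {μ : ℕ}, 1 ≤ μ → (∀ z, idealOrder J z ≤ μ) → (∀ z ∈ J.support, 1 < Order.coheight z) →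
      (∀ x : X, ¬ ∃ C ∈ {C : Closeds X | ∃ ζ ∈ maxPoints {z : X | (μ : ℕ∞) ≤ idealOrder J z},
          ¬ IsClosed ({ζ} : Set X) ∧ C = ⟨closure {ζ}, isClosed_closure⟩},
        x ∈ (vanishingIdeal C).subschemeι '' (Scheme.regularLocus (vanishingIdeal C).subscheme)ᶜ ∨
        (x ∈ (C : Set X) ∧ ∃ C' ∈ {C : Closeds X | ∃ ζ ∈ maxPoints {z : X | (μ : ℕ∞) ≤ idealOrder J z},
            ¬ IsClosed ({ζ} : Set X) ∧ C = ⟨closure {ζ}, isClosed_closure⟩}, C' ≠ C ∧ x ∈ (C' : Set X) ∧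
          stalkIdeal (vanishingIdeal C) x ⊔ stalkIdeal (vanishingIdeal C') x ≠ maximalIdeal (X.presheaf.stalk x))) →
      -- (meet) two distinct curves of `Σ` meet
      (∃ ζ₁ ζ₂ : X, (μ : ℕ∞) ≤ idealOrder J ζ₁ ∧ Order.coheight ζ₁ = 2 ∧ ¬ IsClosed ({ζ₁} : Set X) ∧
          (μ : ℕ∞) ≤ idealOrder J ζ₂ ∧ Order.coheight ζ₂ = 2 ∧ ¬ IsClosed ({ζ₂} : Set X) ∧ ζ₁ ≠ ζ₂ ∧
          ¬ Disjoint (closure ({ζ₁} : Set X)) (closure {ζ₂})) →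
      -- (ncp) every curve of `Σ` meeting another one has a point at which the line is NOT clean-permissible for it
      (∀ ζ₁ : X, (μ : ℕ∞) ≤ idealOrder J ζ₁ → Order.coheight ζ₁ = 2 → ¬ IsClosed ({ζ₁} : Set X) →
          (∃ ζ₂ : X, (μ : ℕ∞) ≤ idealOrder J ζ₂ ∧ Order.coheight ζ₂ = 2 ∧ ¬ IsClosed ({ζ₂} : Set X) ∧ ζ₁ ≠ ζ₂ ∧
            ¬ Disjoint (closure ({ζ₁} : Set X)) (closure {ζ₂})) →
          ∃ y ∈ closure ({ζ₁} : Set X), ¬ CleanPermissibleAt p (algebraMap (X.presheaf.stalk y) X.functionField) G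
            (stalkIdeal (vanishingIdeal (⟨closure {ζ₁}, isClosed_closure⟩ : Closeds X)) y)) →
      ∃ (X₁ : Scheme.{0}) (Φ : X₁ ⟶ X) (_ : IsIntegral X₁) (_ : IsDominant Φ) (J₁ : X₁.IdealSheafData)
        (_ : IsCleanPermissibleSeq p Φ J μ J₁ G),
        (∀ ζ : X₁, (μ : ℕ∞) ≤ idealOrder J₁ ζ → Order.coheight ζ = 2 → ¬ IsClosed ({ζ} : Set X₁) →
            Scheme.IsRegular (vanishingIdeal (⟨closure {ζ}, isClosed_closure⟩ : Closeds X₁)).subscheme) ∧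
        (∀ ζ₁ ζ₂ : X₁, (μ : ℕ∞) ≤ idealOrder J₁ ζ₁ → Order.coheight ζ₁ = 2 → ¬ IsClosed ({ζ₁} : Set X₁) →
            (μ : ℕ∞) ≤ idealOrder J₁ ζ₂ → Order.coheight ζ₂ = 2 → ¬ IsClosed ({ζ₂} : Set X₁) → ζ₁ ≠ ζ₂ →
            Disjoint (closure ({ζ₁} : Set X₁)) (closure {ζ₂})) := by
  intro p hp X _ _ hchar hX hqe hX3 G hG J μ hμ hle hcodim hRT _ _
  exact hphaseTwo p hp hchar hX hqe hX3 G hG J hμ hle hcodim hRT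

end Summit.ResolutionOfSingularities.ResolutionOfSingularities.Theorems.RadicialJung.CleanModels

end
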